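import Mathlib
import Summits.Ventures.HodgeRepro.Tier4.Common.KTypeSpace
import Summits.Ventures.HodgeRepro.Tier4.Common.SettingOfData
import Summits.Ventures.HodgeRepro.Tier4.Line1.IrreducibleSubspace
import Summits.Ventures.HodgeRepro.Tier4.Line1.KernelNondegenerate
import Summits.Ventures.HodgeRepro.Tier4.Line1.LocallyCompactGA
import Summits.Ventures.HodgeRepro.Tier4.Line1.SecondCountableGA
import Summits.Ventures.HodgeRepro.Tier4.Line1.L2InfiniteGA
import Summits.Ventures.HodgeRepro.Tier4.Line1.MaximalFamily
import Summits.Ventures.HodgeRepro.Tier4.Line4.W4SpectralBridge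
import Summits.Ventures.HodgeRepro.Tier4.Line4.W3Reduction
import Summits.Ventures.HodgeRepro.Tier4.Line4.AdaptedONBExtending
import Summits.Ventures.HodgeRepro.Tier4.Line4.AdaptedONBConj

/-!
# Tier4/Line4/W3OfConstituents — the wall W3″ of LINE L4 from BASIS-FREE spectral data: pairwise-orthogonal admissible
constituents with finite-dimensional `K`-type spaces and a block-killing test pair

Blind re-derivation cell `pub-hodge-repro`, Tier 4 «prove the step» (README §9–§10), seat t4-L4-p1 (prover, LINE L4,
gen 3; self-pointed cut S13497).  Tree path `lean/Summits/Ventures/HodgeRepro/Tier4/Line4/W3OfConstituents.lean`.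
Over a GENERIC plane `W` (the skeleton instantiates `W := seesawPlane …`, `w₀ := w₀ d`), on typer-2's
`Setting.ofAdelicData`.

WHAT IS PROVED.  `mixed_two_torus_W3_of_constituents`: W3″'s conclusion (verbatim the conclusion of
`Line4/W3Reduction.mixed_two_torus_W3_of_spectral_data`, t4-L1-p5) from data that mention NO orthonormal basis:
(a) a finite family `V i` of admissible constituents (`IsAdmissibleS`), non-zero, pairwise `L²(D_G)`-orthogonal, with
FINITE-dimensional `K`-type spaces at one level `K` (Harish-Chandra admissibility, displayed);
(b) a test pair `f₁, f₂` with `R(f̄₁)`, `R(f₂ˇ)` acting by the scalars `a i`, `b i` on the CONJUGATE `K`-type space of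
every `V i`, and `R(f̄₁)` killing every continuous invariant function orthogonal to all those conjugate `K`-type spaces
(the block-killing pair: Hecke isolation at the level — W5 proper);
(c) `Jc(f₁ ⋆ f₂) ≠ 0`.
Proof: `AdaptedONBExtending.exists_adaptedONB_extending` builds an adapted ONB whose first constituents are the `V i`
and whose blocks `F i` span the `K`-type spaces (the glue's inputs `hinf`, `h4b` discharged as in L1-p3's
`exists_adaptedONB_ofData`); `AdaptedONBConj.isAdaptedONB_conj` conjugates it (L1's kernel expansion conjugates the
`T`-slot, so W3Reduction reads CONJUGATE blocks); the eigen-relations and the vanishing transfer block by block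
(`inner_eq_zero_of_mem_span_block`); W3Reduction finishes by name.  WHAT IT BUYS: the residual of the wall is now the
binder list (a)–(c) — the orthonormal basis, its blocks, `hdisj` and `hspan` are no longer part of it; the automorphic
content (finiteness of the admissible spectrum at a level, Hecke separation, W5 proper) is untouched and stays
print-facing.

Nothing here says anything about the status of the Hodge conjecture for CM abelian varieties, which is NOT proved
(HC_CM is NOT proved by anyone in this repository).
-/

set_option autoImplicit false

noncomputable section

namespace Summit.Ventures.HodgeRepro.Tier4.Line4

open Summit.Ventures.HodgeRepro.Tier4.Common Summit.Ventures.HodgeRepro.Tier4.Line1 MeasureTheory NumberField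
open scoped ComplexConjugate

section Constituents

variable {k : Type} [Field k] [NumberField k] (W : PlaneData k) [MeasurableSpace (GA W)] [BorelSpace (GA W)]
  (R : RTFData W) (μ : Measure (GA W)) [μ.IsHaarMeasure] [R.μT.IsHaarMeasure] [R.μT'.IsHaarMeasure]
  (DG : Set (GA W)) (fdG : IsFundamentalDomain (rationalPoints W) DG μ) (compG : IsCompact (closure DG))
  (compT : IsCompact (closure R.DT)) (compT' : IsCompact (closure R.DT'))

/-- A member of the span of a block `φ '' F` is continuous and orthogonal to every basis vector `φ j`, `j ∉ F`. -/
theorem inner_eq_zero_of_mem_span_block {τ : ℕ → Set (GA W → ℂ)} {φ : ℕ → GA W → ℂ} {n : ℕ → ℕ}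
    (hB : (Setting.ofAdelicData W R μ DG fdG compG compT compT').IsAdaptedONB τ φ n)
    (F : Finset ℕ) {j : ℕ} (hj : j ∉ F) {u : GA W → ℂ} (hu : u ∈ Submodule.span ℂ (φ '' (F : Set ℕ))) :
    Continuous u ∧ (Setting.ofAdelicData W R μ DG fdG compG compT compT').inner u (φ j) = 0 := by
  set S := Setting.ofAdelicData W R μ DG fdG compG compT compT' with hS
  have hφj : Continuous (φ j) := (hB.inv (n j)).cont _ (hB.mem j)
  refine Submodule.span_induction (p := fun u _ => Continuous u ∧ S.inner u (φ j) = 0) ?_ ?_ ?_ ?_ hu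
  · rintro _ ⟨j', hj', rfl⟩
    refine ⟨(hB.inv (n j')).cont _ (hB.mem j'), ?_⟩
    rw [hB.orth j' j, if_neg]
    intro h
    exact hj (h ▸ Finset.mem_coe.1 hj')
  · exact ⟨continuous_const, S.inner_fun_zero_left _⟩
  · rintro x y _ _ ⟨hxc, hx⟩ ⟨hyc, hy⟩
    refine ⟨hxc.add hyc, ?_⟩
    have e : (x + y : GA W → ℂ) = fun z => x z + y z := rfl
    rw [e, S.inner_add_left_cont hxc hyc hφj, hx, hy, add_zero]
  · rintro c x _ ⟨hxc, hx⟩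
    refine ⟨continuous_const.mul hxc, ?_⟩
    have e : (c • x : GA W → ℂ) = fun z => c * x z := rfl
    rw [e, S.inner_smul_left_cont hxc hφj c, hx, mul_zero]

/-- **W3″ FROM BASIS-FREE SPECTRAL DATA**: a finite family of non-zero, pairwise `L²(D_G)`-orthogonal admissible
constituents `V i` with finite-dimensional `K`-type spaces at the level `K`, a test pair acting by the scalars
`a i`, `b i` on the conjugate `K`-type spaces with `R(f̄₁)` killing their common orthogonal complement (in the
continuous invariant functions), and `Jc(f₁ ⋆ f₂) ≠ 0` — then some `V i` carries, on its `K`-type space, a Riesz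
vector of the `T′`-period with a non-zero `T`-period: the conclusion of the wall `mixed_two_torus_W3` verbatim
(Skeleton v0.17 L456–L470) over a generic plane, by name from `W3Reduction` on the ONB of `AdaptedONBExtending`. -/
theorem mixed_two_torus_W3_of_constituents (hc : Continuous R.chi) (hu : ∀ a, ‖R.chi a‖ = 1)
    (hc' : Continuous R.chi') (hunit' : ∀ t, ‖R.chi' t‖ = 1)
    (q : QuadData k) (g g' : Matrix (Fin 4) (Fin 4) k) (w₀ : InfinitePlace k)
    (eP eM eP' eM' : InfinitePlace k → ℤ) {m : ℕ} (V : Fin m → Submodule ℂ (GA W → ℂ))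
    (hadm : ∀ i, IsAdmissibleS W (Setting.ofAdelicData W R μ DG fdG compG compT compT') q g g' w₀ eP eM eP' eM'
      (V i))
    (hne : ∀ i, V i ≠ ⊥)
    (horth : ∀ i i', i ≠ i' → ∀ ψ ∈ V i, ∀ ψ' ∈ V i',
      (Setting.ofAdelicData W R μ DG fdG compG compT compT').inner ψ ψ' = 0)
    (K : Subgroup (GA W)) (hK : IsCompactOpenIn W (finitePart W) K)
    (hfin : ∀ i, FiniteDimensional ℂ (kTypeSpace W q g g' eP eM eP' eM' K (V i)))
    {f₁ f₂ : GA W → ℂ} (h₁ : IsTestFn W f₁) (h₂ : IsTestFn W f₂) (a b : Fin m → ℂ)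
    (ha : ∀ i, ∀ ψ ∈ kTypeSpace W q g g' eP eM eP' eM' K (V i),
      rightRegular W μ (RTF.cj f₁) (fun x => conj (ψ x)) = fun x => a i * conj (ψ x))
    (hb : ∀ i, ∀ ψ ∈ kTypeSpace W q g g' eP eM eP' eM' K (V i),
      rightRegular W μ (RTF.refl f₂) (fun x => conj (ψ x)) = fun x => b i * conj (ψ x))
    (hvan : ∀ ψ : GA W → ℂ, Continuous ψ →
      (Setting.ofAdelicData W R μ DG fdG compG compT compT').Invariant ψ →
      (∀ i, ∀ w ∈ kTypeSpace W q g g' eP eM eP' eM' K (V i),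
        (Setting.ofAdelicData W R μ DG fdG compG compT compT').inner ψ (fun x => conj (w x)) = 0) →
      rightRegular W μ (RTF.cj f₁) ψ = fun _ => 0)
    (hJ : R.Jc ((Setting.ofAdelicData W R μ DG fdG compG compT compT').conv f₁ f₂) ≠ 0) :
    ∃ V₀ : Submodule ℂ (GA W → ℂ),
      IsAdmissibleS W (Setting.ofAdelicData W R μ DG fdG compG compT compT') q g g' w₀ eP eM eP' eM' V₀ ∧
      ∃ K₀ : Subgroup (GA W), IsCompactOpenIn W (finitePart W) K₀ ∧
        FiniteDimensional ℂ (kTypeSpace W q g g' eP eM eP' eM' K₀ V₀) ∧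
        ∃ f : GA W → ℂ, IsRieszVectorOn R μ DG (kTypeSpace W q g g' eP eM eP' eM' K₀ V₀) f ∧
          periodLin W R.μT R.DT R.chi (restrictTo W (torusT W) f) ≠ 0 := by
  classical
  set S := Setting.ofAdelicData W R μ DG fdG compG compT compT' with hS
  haveI := locallyCompact_GA W
  haveI := secondCountable_GA W
  -- the constituents are non-zero irreducible invariant subspaces
  have hV : ∀ i, S.IsIrrNonzero (V i : Set (GA W → ℂ)) := by
    intro i
    refine ⟨(hadm i).1, (hadm i).2.1, ?_⟩
    obtain ⟨ψ, hψ, hψne⟩ := (Submodule.ne_bot_iff _).1 (hne i)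
    obtain ⟨x, hx⟩ := Function.ne_iff.1 hψne
    exact ⟨ψ, hψ, x, hx⟩
  -- an adapted ONB with the constituents first and blocks spanning the `K`-type spaces
  obtain ⟨τ, φ, n, hB, -, F, hdisj, -, hspan⟩ := exists_adaptedONB_extending S
    (not_finiteDimensional_L2_DG W μ fdG compG)
    (fun V' hV' hcl hne' => S.exists_irreducible_invariant_subspace_of_nondegenerate V' hV' hcl hne'
      S.kernelOp_nondegenerate)
    (fun i => (V i : Set (GA W → ℂ))) hV horth (fun i => kTypeSpace W q g g' eP eM eP' eM' K (V i))
    (fun i => kTypeSpace_le W q g g' eP eM eP' eM' K (V i)) hfin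
  -- the conjugate ONB, whose conjugate blocks are the blocks
  have hB' := isAdaptedONB_conj S hB
  have hspan' : ∀ i, Submodule.span ℂ ((fun j => fun x => conj ((fun j x => conj (φ j x)) j x)) '' (F i : Set ℕ)) =
      kTypeSpace W q g g' eP eM eP' eM' K (V i) := by
    intro i
    rw [← hspan i]
    congr 1
    apply congrArg (· '' (F i : Set ℕ))
    funext j x
    simp only [Complex.conj_conj]
  have hmemK : ∀ i, ∀ j ∈ F i, φ j ∈ kTypeSpace W q g g' eP eM eP' eM' K (V i) := by
    intro i j hj
    rw [← hspan i]
    exact Submodule.subset_span ⟨j, Finset.mem_coe.2 hj, rfl⟩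
  have ha' : ∀ i, ∀ j ∈ F i, rightRegular W μ (RTF.cj f₁) ((fun j x => conj (φ j x)) j) =
      fun x => a i * (fun j x => conj (φ j x)) j x := fun i j hj => ha i (φ j) (hmemK i j hj)
  have hb' : ∀ i, ∀ j ∈ F i, rightRegular W μ (RTF.refl f₂) ((fun j x => conj (φ j x)) j) =
      fun x => b i * (fun j x => conj (φ j x)) j x := fun i j hj => hb i (φ j) (hmemK i j hj)
  have hvan' : ∀ j, (∀ i, j ∉ F i) → rightRegular W μ (RTF.cj f₁) ((fun j x => conj (φ j x)) j) = fun _ => 0 := by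
    intro j hj
    have hφc : Continuous (φ j) := (hB.inv (n j)).cont _ (hB.mem j)
    have hcont : Continuous (fun x => conj (φ j x)) := Complex.continuous_conj.comp hφc
    have hinv : S.Invariant (fun x => conj (φ j x)) := invariant_conj S ((hB.inv (n j)).inv _ (hB.mem j))
    refine hvan _ hcont hinv fun i w hw => ?_
    have hw' : w ∈ Submodule.span ℂ (φ '' (F i : Set ℕ)) := by
      rw [hspan i]
      exact hw
    obtain ⟨hwc, hwo⟩ := inner_eq_zero_of_mem_span_block W R μ DG fdG compG compT compT' hB (F i) (hj i) hw'
    rw [inner_conj_conj, S.inner_conj (S.memLp_restrict_of_continuous hwc) (S.memLp_restrict_of_continuous hφc),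
      hwo, map_zero, map_zero]
  exact mixed_two_torus_W3_of_spectral_data W R μ DG fdG compG compT compT' hc hu hc' hunit' q g g' w₀ eP eM eP' eM'
    V hadm K hK hB' F hdisj hspan' h₁ h₂ a b ha' hb' hvan' hJ

end Constituents

end Summit.Ventures.HodgeRepro.Tier4.Line4

end
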